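/-
Copyright: the b2b-balaban T⁴-continuum CRUX team, row NE7b leaf lineage `t4-ne7b-formalise-leaf-05` (gen 149). Project licence.
-/
import Mathlib.Analysis.Convex.Strong
import Mathlib.Analysis.InnerProductSpace.Basic
import Mathlib.Analysis.MeanInequalities
import Mathlib.Analysis.SpecialFunctions.Pow.Real
import Mathlib.MeasureTheory.Integral.Bochner.Basic
import Mathlib.MeasureTheory.Integral.Bochner.Set
import Mathlib.MeasureTheory.Measure.Dirac

/-!
# THE UPPER LETTER SURVIVES A FLUCTUATION INTEGRAL, DERIVATIVE-FREE: if `x ↦ φ(x) − V(x,y)` is convex for every fibre point `y`, then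
# `x ↦ φ(x) − V⁺(x)` is convex, `V⁺(x) = −log ∫ e^{−V(x,y)} dμ(y)` — Hölder's inequality (log ∫ exp of a fibrewise-convex family is convex);
# with `φ = b‖·‖²`: FIBREWISE SEMICONCAVITY OF MODULUS `b` IS INHERITED BY THE MARGINAL, in the secant currency, with the same `b`
# (row NE7b, node U5c; residual (R2′) family (2); the upper companion of `…LogConcaveMarginal` §3 in the SAME currency, and the
# expansion-point-free form of `…LogConcaveMarginalGrowth`)

Cell `pub-balaban`, sub-cell `t4`, spine estimate NE7b (`T4WeightBudget.RelWeightBound`; the cell's OWN estimate — NOT PRINTED in [Bałaban 1983–89], NOT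
PROVED).  Crux-route work under `Spine/NE7b/`; NOTHING of Bałaban's is named or asserted; no `T4Continuum/Support` leaf typed; no `def`; zero `sorry`.
Mathlib only (`Real.geom_mean_le_arith_mean2_weighted` = weighted AM–GM, `integral_mono`, `integral_exp_pos`, `strongConcaveOn_iff_convex` BY NAME).

WHY.  The windowed convexity road carries two letters about an exponent through a renormalisation step `V ↦ V⁺ = −log ∫ e^{−V(·,y)} dμ(y)`:
the LOWER one (convexity modulus `λ` in the kept variables — `…LogConcaveMarginal`: Prékopa ∕ Brascamp–Lieb, needs JOINT convexity on a convex
window) and the UPPER one (quadratic growth, coefficient `b` — consumed by `…ConvexWindowExponentShift` ∕ `…ConvexWindowTaylorGrowth`;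
`…LogConcaveMarginalGrowth` passes it through ONE step about ONE expansion point `x₀`, in first-order form, using the base derivative `∂ₓV(x₀,·)`
and its tilted mean, and records «NOT HERE: growth letters whose expansion point moves with `y`»).  In the SECANT currency the upper letter needs
no expansion point and no derivative: `x ↦ b‖x‖² − V(x,y)` convex for each `y` (semiconcavity of modulus `b`, equivalently
`a V(p,y) + c V(q,y) ≤ V(a p + c q, y) + b·a·c·‖q − p‖²`) implies the same for `V⁺`, because
`b‖x‖² − V⁺(x) = log ∫ e^{b‖x‖² − V(x,y)} dμ(y)` is the logarithm of an integral of log-convex functions of `x`, and Hölder's inequality says such a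
logarithm is convex.  Nothing about `y` is asked (no convexity, no window shape — any measure space `(α, μ)`, `μ ≠ 0`), the majorant shape `φ` is
arbitrary (a quadratic FORM, a per-block form, `b‖·‖²`), and the output has the INPUT's shape, so the letter passes through a whole tower of steps
with the same `φ` (restricted to slices, §5) — the upper twin of the Prékopa tower.

WHAT IS PROVED ([folklore]):
* §1 **`integral_exp_le_rpow_mul_rpow`**, **`log_integral_exp_le`** — Hölder for exponentials, two-point form: `h ≤ a g₀ + c g₁` a.e., `a, c > 0`,
  `a + c = 1`, `e^{g₀}, e^{g₁}, e^{h}` integrable with `∫e^{g₀}, ∫e^{g₁} > 0` ⟹ `∫ e^{h} ≤ (∫ e^{g₀})^{a} (∫ e^{g₁})^{c}` and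
  `log ∫ e^{h} ≤ a log ∫ e^{g₀} + c log ∫ e^{g₁}` (weighted AM–GM applied to the normalised densities — no `MemLp` bookkeeping).
* §2 **`convexOn_log_integral_exp`** — `B` convex in a real vector space, `g(·,y)` convex on `B` for `μ`-a.e. `y`, `e^{g(x,·)}` integrable for
  `x ∈ B`, `μ ≠ 0` ⟹ `ConvexOn ℝ B (x ↦ log ∫ e^{g(x,y)} dμ)`.
* §3 **`convexOn_sub_neg_log_integral`** (THE UPPER LETTER SURVIVES, any majorant shape `φ : E → ℝ`): `x ↦ φ x − V(x,y)` convex on `B` for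
  `μ`-a.e. `y`, `e^{−V(x,·)}` integrable for `x ∈ B`, `μ ≠ 0` ⟹ `ConvexOn ℝ B (x ↦ φ x − V⁺ x)`; **`convexOn_sub_neg_log_setIntegral`** — the
  same over a FIXED measurable fibre window `F` (`μ F ≠ 0`, `∫ y in F`), the hypothesis asked for `y ∈ F` only.
* §4 the road's quadratic letters (real inner product space): **`strongConcaveOn_neg_log_integral`** — `StrongConcaveOn B m (V(·,y))` for every `y`
  ⟹ `StrongConcaveOn B m V⁺` (ANY real `m`; `m = −2b < 0` is semiconcavity of modulus `b`, i.e. the growth letter in secant form; `m > 0` says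
  strong concavity is inherited too) + `…_setIntegral` twin on a fixed fibre window; **`neg_log_integral_secant_upper`** — the explicit
  secant form `a V⁺(x₀) + c V⁺(x₁) ≤ V⁺(a x₀ + c x₁) + b·a·c·‖x₁ − x₀‖²` from the fibrewise one.
* §5 tower bookkeeping: **`convexOn_slice_fst`** (a convex function of `(x, y)` is convex in `x` on every slice),
  **`convexOn_sub_slice_of_add`** ∕ **`convexOn_sub_of_add_prod`** (an ADDITIVE majorant `φ₁(x) + φ₂(y)` — `b‖x‖² + b‖y‖²` in an `L²` split
  chart, a block-diagonal form — restricts to the majorant `φ₁` on each slice ∕ on `B` for `y ∈ F`: the next step's fibrewise hypothesis IS this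
  step's conclusion); **`convexOn_sub_slice_of_gap`** (NON-additive ∕ block majorants `Q₁₁ x + 2⟪x, B y⟫ + Q₂₂ y`: the BASE BLOCK `Q₁₁` is
  inherited on each slice — not a Schur complement, contrast the lower letter); **`strongConcaveOn_slice_of_split`** — THE CARRIER READING: `StrongConcaveOn K m W` on ONE Euclidean carrier, read through a
  split chart with the Pythagorean letter (`…EuclideanCarrierSplit`'s convention), is fibrewise `StrongConcaveOn` of the same `m` on every slice.
* §6 **`convexOn_sub_twoSteps`** — THE TOWER CLOSES IN THIS CURRENCY: two consecutive steps (`z` over `G`, then `y` over `F`) from the joint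
  hypothesis on `B ×ˢ F` with majorant `φ₁ ⊕ φ₂` to `ConvexOn ℝ B (x ↦ φ₁ x − (−log ∫_{F} ∫_{G} e^{−W((x,y),z)} dν dμ))`, nothing displayed between
  the steps but integrability (of `e^{−W}` on `G`, of the first marginal on `F`).
* a toy `example` (Dirac fibre law: `V⁺ = V(·,y₀)`, the hypotheses are inhabited).

NOT HERE (honest): JOINT (non-product) windows — there the upper letter is NOT inherited (diamond window `K = {|y| ≤ 1 − |x|} ⊆ ℝ × ℝ`, `V = 0`:
`V⁺(x) = −log(2(1 − |x|))` is convex and unbounded at `∂B`, hence `b`-semiconcave for no `b` — the collar phenomenon of the tower; a fixed fibre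
window, or a product window `B ×ˢ F` read through `…ConvexWindowFibres` §3, is what this file covers); the first-order form at a
differentiability point (BY NAME: `UniformConcaveOn.neg` then `…LogConcaveMarginal.firstOrder_of_strongConvexOn_hasFDerivAt` with `λ = m`, any
sign, gives `V⁺ y ≤ V⁺ x + DV⁺(x)(y − x) + b‖y − x‖²` from §4's `StrongConcaveOn B (−2b) V⁺` — not restated); the `L²` split charts
(`…EuclideanCarrierSplit`); which exponents of print are fibrewise semiconcave in which chart ((A3)); anything of Bałaban's.  BY-NAME EFFECT ON
THE WALL: NONE.  NE7b NOT PRINTED ∕ NOT PROVED; spine PROVED 0∕9; rung (B)+1 on a FINITE torus — NOT infinite volume, NOT the mass gap, NOT Clay.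
HONEST DEPENDENCY: continuum YM on T⁴ ⇐ BetaPertH ∧ nine spine estimates (0/9 proved); BetaPertH ⇐ (D1) ∧ (D4) ∧ CAP+tail.
-/

set_option autoImplicit false

noncomputable section

open MeasureTheory Real Set

namespace Summit.QuantumFields.BalabanUV.T4Continuum.NE7b.SemiconcaveMarginal

/-! ## §1 Hölder for exponentials, two-point form (weighted AM–GM after normalisation) -/

section Holder

variable {α : Type*} [MeasurableSpace α] {μ : Measure α}

/-- **HÖLDER FOR EXPONENTIALS** (two-point form).  If `h ≤ a·g₀ + c·g₁` `μ`-a.e. with `a, c > 0`, `a + c = 1`, the three exponentials are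
integrable and `X = ∫ e^{g₀} > 0`, `Y = ∫ e^{g₁} > 0`, then `∫ e^{h} ≤ X^{a}·Y^{c}`.  Proof: pointwise `e^{h} ≤ (e^{g₀})^{a}(e^{g₁})^{c} =
X^{a}Y^{c}·(e^{g₀}∕X)^{a}(e^{g₁}∕Y)^{c} ≤ X^{a}Y^{c}·(a·e^{g₀}∕X + c·e^{g₁}∕Y)` (weighted AM–GM), and the last function integrates to `X^{a}Y^{c}`.
[folklore] -/
theorem integral_exp_le_rpow_mul_rpow {g₀ g₁ h : α → ℝ} {a c : ℝ} (ha : 0 < a) (hc : 0 < c) (hac : a + c = 1)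
    (hg₀ : Integrable (fun y => exp (g₀ y)) μ) (hg₁ : Integrable (fun y => exp (g₁ y)) μ)
    (hh : Integrable (fun y => exp (h y)) μ)
    (hX : 0 < ∫ y, exp (g₀ y) ∂μ) (hY : 0 < ∫ y, exp (g₁ y) ∂μ)
    (hle : ∀ᵐ y ∂μ, h y ≤ a * g₀ y + c * g₁ y) :
    ∫ y, exp (h y) ∂μ ≤ (∫ y, exp (g₀ y) ∂μ) ^ a * (∫ y, exp (g₁ y) ∂μ) ^ c := by
  set X := ∫ y, exp (g₀ y) ∂μ with hXdef
  set Y := ∫ y, exp (g₁ y) ∂μ with hYdef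
  have hXa : 0 < X ^ a := rpow_pos_of_pos hX a
  have hYc : 0 < Y ^ c := rpow_pos_of_pos hY c
  -- the pointwise (a.e.) majorant
  have hpt : ∀ᵐ y ∂μ, exp (h y) ≤ X ^ a * Y ^ c * (a * (exp (g₀ y) / X) + c * (exp (g₁ y) / Y)) := by
    filter_upwards [hle] with y hy
    have h1 : exp (h y) ≤ exp (g₀ y) ^ a * exp (g₁ y) ^ c := by
      rw [← exp_mul, ← exp_mul, ← exp_add]
      exact exp_le_exp.2 (by nlinarith [hy])
    have h2 : exp (g₀ y) ^ a * exp (g₁ y) ^ c = X ^ a * Y ^ c * ((exp (g₀ y) / X) ^ a * (exp (g₁ y) / Y) ^ c) := by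
      rw [div_rpow (exp_pos _).le hX.le, div_rpow (exp_pos _).le hY.le]
      field_simp
    have h3 : (exp (g₀ y) / X) ^ a * (exp (g₁ y) / Y) ^ c ≤ a * (exp (g₀ y) / X) + c * (exp (g₁ y) / Y) :=
      geom_mean_le_arith_mean2_weighted ha.le hc.le (div_nonneg (exp_pos _).le hX.le)
        (div_nonneg (exp_pos _).le hY.le) hac
    calc exp (h y) ≤ exp (g₀ y) ^ a * exp (g₁ y) ^ c := h1
      _ = X ^ a * Y ^ c * ((exp (g₀ y) / X) ^ a * (exp (g₁ y) / Y) ^ c) := h2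
      _ ≤ X ^ a * Y ^ c * (a * (exp (g₀ y) / X) + c * (exp (g₁ y) / Y)) :=
          mul_le_mul_of_nonneg_left h3 (mul_pos hXa hYc).le
  have hI₀ : Integrable (fun y => a * (exp (g₀ y) / X)) μ := (hg₀.div_const X).const_mul a
  have hI₁ : Integrable (fun y => c * (exp (g₁ y) / Y)) μ := (hg₁.div_const Y).const_mul c
  have hmaj : Integrable (fun y => X ^ a * Y ^ c * (a * (exp (g₀ y) / X) + c * (exp (g₁ y) / Y))) μ :=
    (hI₀.add hI₁).const_mul _
  -- integrate the majorant
  have hval : ∫ y, X ^ a * Y ^ c * (a * (exp (g₀ y) / X) + c * (exp (g₁ y) / Y)) ∂μ = X ^ a * Y ^ c := by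
    rw [integral_const_mul, integral_add hI₀ hI₁, integral_const_mul, integral_const_mul, integral_div, integral_div,
      ← hXdef, ← hYdef, div_self hX.ne', div_self hY.ne', mul_one, mul_one, hac, mul_one]
  calc ∫ y, exp (h y) ∂μ ≤ ∫ y, X ^ a * Y ^ c * (a * (exp (g₀ y) / X) + c * (exp (g₁ y) / Y)) ∂μ :=
        integral_mono_ae hh hmaj hpt
    _ = X ^ a * Y ^ c := hval

/-- **HÖLDER FOR EXPONENTIALS, logarithmic form**: under the hypotheses of `integral_exp_le_rpow_mul_rpow`,
`log ∫ e^{h} ≤ a·log ∫ e^{g₀} + c·log ∫ e^{g₁}`. [folklore] -/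
theorem log_integral_exp_le {g₀ g₁ h : α → ℝ} {a c : ℝ} (ha : 0 < a) (hc : 0 < c) (hac : a + c = 1)
    (hg₀ : Integrable (fun y => exp (g₀ y)) μ) (hg₁ : Integrable (fun y => exp (g₁ y)) μ)
    (hh : Integrable (fun y => exp (h y)) μ)
    (hX : 0 < ∫ y, exp (g₀ y) ∂μ) (hY : 0 < ∫ y, exp (g₁ y) ∂μ)
    (hle : ∀ᵐ y ∂μ, h y ≤ a * g₀ y + c * g₁ y) :
    log (∫ y, exp (h y) ∂μ) ≤ a * log (∫ y, exp (g₀ y) ∂μ) + c * log (∫ y, exp (g₁ y) ∂μ) := by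
  haveI : NeZero μ := ⟨fun h0 => by simp [h0] at hX⟩
  have hZ : 0 < ∫ y, exp (h y) ∂μ := integral_exp_pos hh
  have key := log_le_log hZ (integral_exp_le_rpow_mul_rpow ha hc hac hg₀ hg₁ hh hX hY hle)
  rwa [log_mul (rpow_pos_of_pos hX a).ne' (rpow_pos_of_pos hY c).ne', log_rpow hX, log_rpow hY] at key

end Holder

/-! ## §2 The logarithm of an integral of log-convex functions is convex -/

section LogIntegralExp

variable {E : Type*} [AddCommGroup E] [Module ℝ E] {α : Type*} [MeasurableSpace α] {μ : Measure α}

/-- **`log ∫ exp` OF A FIBREWISE-CONVEX FAMILY IS CONVEX**: `B` convex, `x ↦ g(x,y)` convex on `B` for `μ`-a.e. `y`, `e^{g(x,·)}` integrable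
for `x ∈ B`, `μ ≠ 0` ⟹ `ConvexOn ℝ B (x ↦ log ∫ e^{g(x,y)} dμ(y))` (Hölder, §1, at the two endpoints). [folklore] -/
theorem convexOn_log_integral_exp [NeZero μ] {B : Set E} (hB : Convex ℝ B) {g : E × α → ℝ}
    (hg : ∀ᵐ y ∂μ, ConvexOn ℝ B (fun x => g (x, y)))
    (hint : ∀ x ∈ B, Integrable (fun y => exp (g (x, y))) μ) :
    ConvexOn ℝ B (fun x => log (∫ y, exp (g (x, y)) ∂μ)) := by
  refine ⟨hB, fun x₀ hx₀ x₁ hx₁ a c ha hc hac => ?_⟩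
  rcases ha.eq_or_lt with rfl | ha0
  · have hc1 : c = 1 := by linarith
    subst hc1; simp
  rcases hc.eq_or_lt with rfl | hc0
  · have ha1 : a = 1 := by linarith
    subst ha1; simp
  have hxs : a • x₀ + c • x₁ ∈ B := hB hx₀ hx₁ ha hc hac
  simp only [smul_eq_mul]
  refine log_integral_exp_le ha0 hc0 hac (hint x₀ hx₀) (hint x₁ hx₁) (hint _ hxs)
    (integral_exp_pos (hint x₀ hx₀)) (integral_exp_pos (hint x₁ hx₁)) ?_
  filter_upwards [hg] with y hy
  have h := hy.2 hx₀ hx₁ ha hc hac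
  simpa only [smul_eq_mul] using h

end LogIntegralExp

/-! ## §3 THE UPPER LETTER SURVIVES: `φ − V(·,y)` convex for every `y` ⟹ `φ − V⁺` convex -/

section UpperLetter

variable {E : Type*} [AddCommGroup E] [Module ℝ E] {α : Type*} [MeasurableSpace α] {μ : Measure α}

/-- **THE UPPER LETTER SURVIVES THE FLUCTUATION INTEGRAL** (any majorant shape).  Let `φ : E → ℝ`, `V : E × α → ℝ`, `B ⊆ E` convex, and suppose
that for `μ`-a.e. fibre point `y` the function `x ↦ φ x − V(x,y)` is convex on `B` («`V(·,y)` is `φ`-semiconcave»), that `e^{−V(x,·)}` is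
`μ`-integrable for `x ∈ B`, and `μ ≠ 0`.  Then `x ↦ φ x − V⁺ x` is convex on `B`, where `V⁺ x = −log ∫ e^{−V(x,y)} dμ(y)`: the marginal exponent is
`φ`-semiconcave with the SAME `φ`.  (`φ x − V⁺ x = log ∫ e^{φ x − V(x,y)} dμ`, and §2.)  No convexity in `y`, no window shape, no derivative. [folklore] -/
theorem convexOn_sub_neg_log_integral [NeZero μ] {B : Set E} (hB : Convex ℝ B) (φ : E → ℝ) {V : E × α → ℝ}
    (hV : ∀ᵐ y ∂μ, ConvexOn ℝ B (fun x => φ x - V (x, y)))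
    (hint : ∀ x ∈ B, Integrable (fun y => exp (-V (x, y))) μ) :
    ConvexOn ℝ B (fun x => φ x - -log (∫ y, exp (-V (x, y)) ∂μ)) := by
  have hint' : ∀ x ∈ B, Integrable (fun y => exp (φ x - V (x, y))) μ := fun x hx => by
    simp_rw [sub_eq_add_neg, exp_add]
    exact (hint x hx).const_mul _
  have h := convexOn_log_integral_exp hB (g := fun p => φ p.1 - V p) hV hint'
  refine h.congr (fun x hx => ?_)
  show log (∫ y, exp (φ x - V (x, y)) ∂μ) = φ x - -log (∫ y, exp (-V (x, y)) ∂μ)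
  simp_rw [sub_eq_add_neg (φ x), exp_add]
  rw [integral_const_mul, log_mul (exp_pos _).ne' (integral_exp_pos (hint x hx)).ne', log_exp, neg_neg]

/-- **THE UPPER LETTER SURVIVES, FIXED FIBRE WINDOW**: the same over a measurable fibre set `F` with `μ F ≠ 0`, the hypothesis asked only ON
the window: `x ↦ φ x − V(x,y)` convex on `B` for every `y ∈ F`, `e^{−V(x,·)}` integrable on `F` for `x ∈ B` ⟹
`ConvexOn ℝ B (x ↦ φ x − (−log ∫_{F} e^{−V(x,y)} dμ))`. [folklore] -/
theorem convexOn_sub_neg_log_setIntegral {F : Set α} (hFm : MeasurableSet F) (hF : μ F ≠ 0) {B : Set E} (hB : Convex ℝ B)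
    (φ : E → ℝ) {V : E × α → ℝ} (hV : ∀ y ∈ F, ConvexOn ℝ B (fun x => φ x - V (x, y)))
    (hint : ∀ x ∈ B, IntegrableOn (fun y => exp (-V (x, y))) F μ) :
    ConvexOn ℝ B (fun x => φ x - -log (∫ y in F, exp (-V (x, y)) ∂μ)) := by
  haveI : NeZero (μ F) := ⟨hF⟩
  exact convexOn_sub_neg_log_integral (μ := μ.restrict F) hB φ ((ae_restrict_iff' hFm).2 (ae_of_all μ hV)) hint

end UpperLetter

/-! ## §4 The road's quadratic letters: semiconcavity ∕ strong concavity of modulus `m` is inherited -/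

section Quadratic

variable {E : Type*} [NormedAddCommGroup E] [InnerProductSpace ℝ E] {α : Type*} [MeasurableSpace α] {μ : Measure α}

/-- **FIBREWISE (a.e.) `StrongConcaveOn B m` ⟹ `StrongConcaveOn B m` FOR THE MARGINAL**, any real `m` (real inner product space; Mathlib's
`StrongConcaveOn B m f` is `a f x + c f y + (m∕2)·a·c·‖x − y‖² ≤ f(a x + c y)`, equivalently `x ↦ f x + (m∕2)‖x‖²` concave).  For `m = −2b < 0`
this is SEMICONCAVITY OF MODULUS `b` — the growth letter in secant form, `a V⁺ x + c V⁺ y ≤ V⁺(a x + c y) + b·a·c·‖x − y‖²` — inherited with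
the same `b`; for `m > 0` strong concavity is inherited.  Contrast `…LogConcaveMarginal.strongConvexOn_neg_log_integral` (the LOWER letter), which
needs JOINT convexity of `V`; here only each `V(·,y)` is constrained. [folklore] -/
theorem strongConcaveOn_neg_log_integral [NeZero μ] {B : Set E} (hB : Convex ℝ B) {m : ℝ} {V : E × α → ℝ}
    (hV : ∀ᵐ y ∂μ, StrongConcaveOn B m (fun x => V (x, y)))
    (hint : ∀ x ∈ B, Integrable (fun y => exp (-V (x, y))) μ) :
    StrongConcaveOn B m (fun x => -log (∫ y, exp (-V (x, y)) ∂μ)) := by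
  rw [strongConcaveOn_iff_convex]
  have hV' : ∀ᵐ y ∂μ, ConvexOn ℝ B (fun x => -(m / 2 * ‖x‖ ^ 2) - V (x, y)) := by
    filter_upwards [hV] with y hy
    have h := (strongConcaveOn_iff_convex.1 hy).neg
    refine h.congr (fun x _ => ?_)
    simp only [Pi.neg_apply]; ring
  have h := (convexOn_sub_neg_log_integral hB (fun x => -(m / 2 * ‖x‖ ^ 2)) hV' hint).neg
  refine h.congr (fun x _ => ?_)
  simp only [Pi.neg_apply]; ring

/-- The same on a FIXED measurable FIBRE WINDOW `F` (`μ F ≠ 0`, `∫ y in F`), the hypothesis asked for `y ∈ F` only. [folklore] -/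
theorem strongConcaveOn_neg_log_setIntegral {F : Set α} (hFm : MeasurableSet F) (hF : μ F ≠ 0) {B : Set E} (hB : Convex ℝ B)
    {m : ℝ} {V : E × α → ℝ} (hV : ∀ y ∈ F, StrongConcaveOn B m (fun x => V (x, y)))
    (hint : ∀ x ∈ B, IntegrableOn (fun y => exp (-V (x, y))) F μ) :
    StrongConcaveOn B m (fun x => -log (∫ y in F, exp (-V (x, y)) ∂μ)) := by
  haveI : NeZero (μ F) := ⟨hF⟩
  exact strongConcaveOn_neg_log_integral (μ := μ.restrict F) hB ((ae_restrict_iff' hFm).2 (ae_of_all μ hV)) hint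

/-- **THE GROWTH LETTER IN SECANT FORM IS INHERITED WITH THE SAME COEFFICIENT** (explicit form).  If for `μ`-a.e. fibre point `y` and all
`x₀, x₁ ∈ B`, `a, c ≥ 0`, `a + c = 1`: `a V(x₀,y) + c V(x₁,y) ≤ V(a x₀ + c x₁, y) + b·a·c·‖x₁ − x₀‖²`, the densities `e^{−V(x,·)}` are integrable for
`x ∈ B` (`B` convex, `μ ≠ 0`), then the marginal exponent `F x = −log ∫ e^{−V(x,y)} dμ` obeys
`a F(x₀) + c F(x₁) ≤ F(a x₀ + c x₁) + b·a·c·‖x₁ − x₀‖²` for all such `x₀, x₁, a, c`. [folklore] -/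
theorem neg_log_integral_secant_upper [NeZero μ] {B : Set E} (hB : Convex ℝ B) {b : ℝ} {V : E × α → ℝ}
    (hV : ∀ᵐ y ∂μ, ∀ x₀ ∈ B, ∀ x₁ ∈ B, ∀ a c : ℝ, 0 ≤ a → 0 ≤ c → a + c = 1 →
      a * V (x₀, y) + c * V (x₁, y) ≤ V (a • x₀ + c • x₁, y) + b * a * c * ‖x₁ - x₀‖ ^ 2)
    (hint : ∀ x ∈ B, Integrable (fun y => exp (-V (x, y))) μ)
    {x₀ x₁ : E} (hx₀ : x₀ ∈ B) (hx₁ : x₁ ∈ B) {a c : ℝ} (ha : 0 ≤ a) (hc : 0 ≤ c) (hac : a + c = 1) :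
    a * -log (∫ y, exp (-V (x₀, y)) ∂μ) + c * -log (∫ y, exp (-V (x₁, y)) ∂μ) ≤
      -log (∫ y, exp (-V (a • x₀ + c • x₁, y)) ∂μ) + b * a * c * ‖x₁ - x₀‖ ^ 2 := by
  have hV' : ∀ᵐ y ∂μ, StrongConcaveOn B (-(2 * b)) (fun x => V (x, y)) := by
    filter_upwards [hV] with y hy
    refine ⟨hB, fun x₀ hx₀ x₁ hx₁ a c ha hc hac => ?_⟩
    have h := hy x₀ hx₀ x₁ hx₁ a c ha hc hac
    rw [norm_sub_rev x₁ x₀] at h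
    simp only [smul_eq_mul]
    nlinarith [h]
  have h := (strongConcaveOn_neg_log_integral hB hV' hint).2 hx₀ hx₁ ha hc hac
  rw [norm_sub_rev x₀ x₁] at h
  simp only [smul_eq_mul] at h
  nlinarith [h]

end Quadratic

/-! ## §5 Tower bookkeeping: the conclusion restricts to the next step's fibrewise hypothesis -/

section Tower

variable {E₁ E₂ : Type*} [AddCommGroup E₁] [Module ℝ E₁] [AddCommGroup E₂] [Module ℝ E₂]

/-- A convex function of `(x, y)` on `S` is convex in `x` on every slice `{x | (x, y) ∈ S}`. [folklore] -/
theorem convexOn_slice_fst {S : Set (E₁ × E₂)} {f : E₁ × E₂ → ℝ} (hf : ConvexOn ℝ S f) (y : E₂) :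
    ConvexOn ℝ {x | (x, y) ∈ S} (fun x => f (x, y)) := by
  have hlin : ∀ (x₀ x₁ : E₁) (a c : ℝ), a + c = 1 → (a • x₀ + c • x₁, y) = a • (x₀, y) + c • (x₁, y) := by
    intro x₀ x₁ a c hac
    rw [Prod.smul_mk, Prod.smul_mk, Prod.mk_add_mk, ← add_smul, hac, one_smul]
  refine ⟨fun x₀ hx₀ x₁ hx₁ a c ha hc hac => ?_, fun x₀ hx₀ x₁ hx₁ a c ha hc hac => ?_⟩
  · show (a • x₀ + c • x₁, y) ∈ S
    rw [hlin x₀ x₁ a c hac]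
    exact hf.1 hx₀ hx₁ ha hc hac
  · have h := hf.2 hx₀ hx₁ ha hc hac
    rw [← hlin x₀ x₁ a c hac] at h
    exact h

/-- **AN ADDITIVE MAJORANT RESTRICTS TO ITS FIRST SUMMAND ON A SLICE**: if `(x, y) ↦ φ₁ x + φ₂ y − W(x, y)` is convex on `S`, then for every `y`
the function `x ↦ φ₁ x − W(x, y)` is convex on the slice `{x | (x, y) ∈ S}` (the constant `φ₂ y` drops) — so the CONCLUSION of §3 for a step
with kept variables `(x, y)` and majorant `φ₁ ⊕ φ₂` (e.g. `b‖x‖² + b‖y‖²` in an `L²` split chart, or a block-diagonal form) IS the fibrewise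
HYPOTHESIS of §3 for the next step that integrates `y`, with majorant `φ₁`. [folklore] -/
theorem convexOn_sub_slice_of_add {S : Set (E₁ × E₂)} (φ₁ : E₁ → ℝ) (φ₂ : E₂ → ℝ) {W : E₁ × E₂ → ℝ}
    (h : ConvexOn ℝ S (fun z => φ₁ z.1 + φ₂ z.2 - W z)) (y : E₂) :
    ConvexOn ℝ {x | (x, y) ∈ S} (fun x => φ₁ x - W (x, y)) := by
  have hs := convexOn_slice_fst h y
  have hc : ConvexOn ℝ {x | (x, y) ∈ S} (fun _ : E₁ => -φ₂ y) := convexOn_const _ hs.1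
  refine (hs.add hc).congr (fun x _ => ?_)
  simp only [Pi.add_apply]
  ring

/-- **PRODUCT WINDOWS**: if `(x, y) ↦ φ₁ x + φ₂ y − W(x, y)` is convex on `B ×ˢ F`, then for every `y ∈ F` the function `x ↦ φ₁ x − W(x, y)` is
convex on `B` — literally the `∀ y ∈ F` hypothesis of `convexOn_sub_neg_log_setIntegral` for the step that integrates `y` over `F`. [folklore] -/
theorem convexOn_sub_of_add_prod {B : Set E₁} {F : Set E₂} (φ₁ : E₁ → ℝ) (φ₂ : E₂ → ℝ) {W : E₁ × E₂ → ℝ}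
    (h : ConvexOn ℝ (B ×ˢ F) (fun z => φ₁ z.1 + φ₂ z.2 - W z)) {y : E₂} (hy : y ∈ F) :
    ConvexOn ℝ B (fun x => φ₁ x - W (x, y)) := by
  have hs := convexOn_sub_slice_of_add φ₁ φ₂ h y
  have hB : {x | (x, y) ∈ B ×ˢ F} = B := by
    ext x
    simp only [mem_setOf_eq, mem_prod, hy, and_true]
  rwa [hB] at hs

/-- **BLOCK MAJORANTS: THE BASE BLOCK IS INHERITED ON EACH SLICE** (non-additive shapes — a joint quadratic form with cross terms, a sheared
chart): if `z ↦ φ z − W z` is convex on `S` and, on the slice at `y`, `x ↦ ψ x − φ(x, y)` is convex (e.g. AFFINE: for a block form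
`φ(x,y) = Q₁₁ x + 2⟪x, B y⟫ + Q₂₂ y` take `ψ = Q₁₁`), then `x ↦ ψ x − W(x, y)` is convex on the slice — the upper letter keeps the BASE BLOCK
`Q₁₁` (not a Schur complement: contrast the lower letter, `…ConvexityModulusSchur`). [folklore] -/
theorem convexOn_sub_slice_of_gap {S : Set (E₁ × E₂)} (φ : E₁ × E₂ → ℝ) (ψ : E₁ → ℝ) {W : E₁ × E₂ → ℝ}
    (h : ConvexOn ℝ S (fun z => φ z - W z)) (y : E₂) (hgap : ConvexOn ℝ {x | (x, y) ∈ S} (fun x => ψ x - φ (x, y))) :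
    ConvexOn ℝ {x | (x, y) ∈ S} (fun x => ψ x - W (x, y)) :=
  ((convexOn_slice_fst h y).add hgap).congr (fun x _ => by simp only [Pi.add_apply]; ring)

/-- **THE CARRIER READING** (one Euclidean carrier `G`, a split chart `S : G ≃L X × Y` with the Pythagorean letter
`‖z‖² = ‖(S z).1‖² + ‖(S z).2‖²` — `…EuclideanCarrierSplit`'s convention): `StrongConcaveOn K m W` on the carrier is FIBREWISE
`StrongConcaveOn` of the SAME modulus `m` in the base variable on every slice `{x | S⁻¹(x, y) ∈ K}` — §4's output at one step, read through
the next step's chart, IS §4's fibrewise hypothesis at the next step (for `K ⊇ S⁻¹(B ×ˢ F)` and `y ∈ F` the slice contains `B`). [folklore] -/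
theorem strongConcaveOn_slice_of_split {G X Y : Type*} [NormedAddCommGroup G] [InnerProductSpace ℝ G] [NormedAddCommGroup X]
    [InnerProductSpace ℝ X] [NormedAddCommGroup Y] [InnerProductSpace ℝ Y] (S : G ≃L[ℝ] X × Y)
    (hSn : ∀ z, ‖z‖ ^ 2 = ‖(S z).1‖ ^ 2 + ‖(S z).2‖ ^ 2) {K : Set G} {W : G → ℝ} {m : ℝ}
    (hW : StrongConcaveOn K m W) (y : Y) :
    StrongConcaveOn {x | S.symm (x, y) ∈ K} m (fun x => W (S.symm (x, y))) := by
  rw [strongConcaveOn_iff_convex] at hW ⊢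
  have h1 := (hW.comp_linearMap S.symm.toLinearEquiv.toLinearMap).neg
  have h2 := convexOn_slice_fst h1 y
  have hn : ∀ x : X, ‖S.symm (x, y)‖ ^ 2 = ‖x‖ ^ 2 + ‖y‖ ^ 2 := fun x => by
    have := hSn (S.symm (x, y)); rwa [S.apply_symm_apply] at this
  refine ⟨h2.1, fun x₀ hx₀ x₁ hx₁ a c ha hc hac => ?_⟩
  have key := h2.2 hx₀ hx₁ ha hc hac
  simp only [Function.comp_apply, Pi.neg_apply, smul_eq_mul, LinearEquiv.coe_coe, ContinuousLinearEquiv.coe_toLinearEquiv] at key ⊢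
  rw [hn x₀, hn x₁, hn (a • x₀ + c • x₁)] at key
  have hy : a * (m / 2 * ‖y‖ ^ 2) + c * (m / 2 * ‖y‖ ^ 2) = m / 2 * ‖y‖ ^ 2 := by rw [← add_mul, hac, one_mul]
  linarith [key, hy]

end Tower

/-! ## §6 The tower closes in this currency: two consecutive steps, nothing displayed but integrability -/

section TwoSteps

variable {E₁ E₂ : Type*} [AddCommGroup E₁] [Module ℝ E₁] [AddCommGroup E₂] [Module ℝ E₂]
  [MeasurableSpace E₂] {μ : Measure E₂} {γ : Type*} [MeasurableSpace γ] {ν : Measure γ}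

/-- **TWO STEPS.**  Kept variables `(x, y) ∈ B ×ˢ F` (both convex, `F` measurable, `μ F ≠ 0`), first fluctuation variable `z` over the window `G`
(`ν G ≠ 0`, measurable), exponent `W((x,y),z)`, ADDITIVE majorant `φ₁ x + φ₂ y`.  If `(x,y) ↦ φ₁ x + φ₂ y − W((x,y),z)` is convex on
`B ×ˢ F` for every `z ∈ G`, the densities `e^{−W(p,·)}` are integrable on `G` for `p ∈ B ×ˢ F`, and the first marginal
`y ↦ ∫_{G} e^{−W((x,y),z)} dν` is integrable on `F` for `x ∈ B`, then after integrating `z` AND THEN `y` the exponent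
`W⁺⁺(x) = −log ∫_{F} e^{−W⁺(x,y)} dμ = −log ∫_{F} ∫_{G} e^{−W((x,y),z)} dν dμ`, `W⁺(x,y) = −log ∫_{G} e^{−W((x,y),z)} dν`, is `φ₁`-semiconcave on `B`:
`ConvexOn ℝ B (x ↦ φ₁ x − W⁺⁺ x)`.  The first step's conclusion (§3) is restricted to slices (§5) and fed to the second step (§3) — no letter is
re-read between the steps. [folklore] -/
theorem convexOn_sub_twoSteps {B : Set E₁} (hB : Convex ℝ B) {F : Set E₂} (hF : Convex ℝ F) (hFm : MeasurableSet F) (hF0 : μ F ≠ 0)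
    {G : Set γ} (hGm : MeasurableSet G) (hG0 : ν G ≠ 0) (φ₁ : E₁ → ℝ) (φ₂ : E₂ → ℝ) {W : (E₁ × E₂) × γ → ℝ}
    (hW : ∀ z ∈ G, ConvexOn ℝ (B ×ˢ F) (fun p => φ₁ p.1 + φ₂ p.2 - W (p, z)))
    (hint₁ : ∀ p ∈ B ×ˢ F, IntegrableOn (fun z => exp (-W (p, z))) G ν)
    (hint₂ : ∀ x ∈ B, IntegrableOn (fun y => ∫ z in G, exp (-W ((x, y), z)) ∂ν) F μ) :
    ConvexOn ℝ B (fun x => φ₁ x - -log (∫ y in F, ∫ z in G, exp (-W ((x, y), z)) ∂ν ∂μ)) := by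
  haveI : NeZero (ν G) := ⟨hG0⟩
  -- the first marginal is positive on the window, so `e^{−W⁺} = ∫_G e^{−W}` there
  have hpos : ∀ x ∈ B, ∀ y ∈ F, 0 < ∫ z in G, exp (-W ((x, y), z)) ∂ν := fun x hx y hy =>
    integral_exp_pos (μ := ν.restrict G) (hint₁ (x, y) ⟨hx, hy⟩)
  have hexp : ∀ x ∈ B, EqOn (fun y => exp (-(-log (∫ z in G, exp (-W ((x, y), z)) ∂ν))))
      (fun y => ∫ z in G, exp (-W ((x, y), z)) ∂ν) F := fun x hx y hy => by
    simp only [neg_neg, exp_log (hpos x hx y hy)]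
  -- step 1: integrate `z`; the majorant `φ₁ ⊕ φ₂` survives on `B ×ˢ F`
  have h1 : ConvexOn ℝ (B ×ˢ F) (fun p => (φ₁ p.1 + φ₂ p.2) - -log (∫ z in G, exp (-W (p, z)) ∂ν)) :=
    convexOn_sub_neg_log_setIntegral hGm hG0 (hB.prod hF) (fun p => φ₁ p.1 + φ₂ p.2) hW hint₁
  -- restrict to slices `y ∈ F`: the second step's fibrewise hypothesis
  have h2 : ∀ y ∈ F, ConvexOn ℝ B (fun x => φ₁ x - -log (∫ z in G, exp (-W ((x, y), z)) ∂ν)) :=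
    fun y hy => convexOn_sub_of_add_prod φ₁ φ₂ (W := fun p => -log (∫ z in G, exp (-W (p, z)) ∂ν)) h1 hy
  -- step 2: integrate `y` (the density of the second step is the first marginal itself)
  have h3 := convexOn_sub_neg_log_setIntegral hFm hF0 hB φ₁ (V := fun q => -log (∫ z in G, exp (-W ((q.1, q.2), z)) ∂ν)) h2
    (fun x hx => (hint₂ x hx).congr_fun (hexp x hx).symm hFm)
  refine h3.congr (fun x hx => ?_)
  simp only [setIntegral_congr_fun hFm (hexp x hx)]

end TwoSteps

/-! ## A toy: the hypotheses are inhabited (Dirac fibre law — the marginal of `V` is `V(·,y₀)`) -/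

/-- Toy (NOT a claim about any model): base `ℝ`, fibre law `δ_{y₀}` on `ℝ`, `V(x,y) = x² + y`, majorant `φ = ‖·‖²`; `x ↦ ‖x‖² − V(x,y) = −y`
is convex for each `y`, so §3 applies. -/
example (y₀ : ℝ) :
    ConvexOn ℝ univ (fun x : ℝ => ‖x‖ ^ 2 - -log (∫ y, exp (-(x ^ 2 + y)) ∂Measure.dirac y₀)) := by
  refine convexOn_sub_neg_log_integral (μ := Measure.dirac y₀) (V := fun p : ℝ × ℝ => p.1 ^ 2 + p.2) convex_univ
    (fun x : ℝ => ‖x‖ ^ 2) (ae_of_all _ (fun y => ?_)) (fun x _ => ?_)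
  · refine (convexOn_const (-y) convex_univ).congr (fun x _ => ?_)
    simp only [Real.norm_eq_abs, sq_abs]
    ring
  · exact integrable_dirac (by simp)

end Summit.QuantumFields.BalabanUV.T4Continuum.NE7b.SemiconcaveMarginal
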